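import Summits.QuantumFields.YangMills.Theorems.SwapVirialDeficitSectorLaplaceSmearing
import Summits.QuantumFields.YangMills.Theorems.SwapVirialDeficitSigmaBallEndSlab
import HarnessLib

/-!
# THE SMEARED SLAB–SHELL COMPARISON — N3-core of LEAD g99's memo11 §3 for `stub_end_gaussCore` (pure real analysis)
# (free-hands support of ⟨stmt-QuantumFields-24197⟩ `SwapVirialDeficit.SwapGluedStiffness`)

After the followers are integrated exactly and the transverse leaders by w3 g67's ✓`lintegral_hubSlab_leader_le`, the end slab and its adjacent bulk shell are
`δ`-families of functions of the base point `p = (x₀, y₀) ∈ ℝ²` of the shape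
    slab:  `F_s(δ, p) ≤ A_s · D(p) · w(p) · B₀(δ,p)⁻¹`   (`|δ| < s`),        shell: `A_sh · D(p) · w(p) ≤ F_sh(δ′, p)`   (`δ′ ∈ [r/2, r]`),
with the E1 weight `w(p) = (1+x₀²)⁻¹(1+y₀²)⁻¹`, LEAD's rate `B₀(δ,x₀,y₀) = 16δ²/(1+δ²) + 8x₀²/((1+x₀²)(1+δ²)) + 4y₀²/(1+y₀²)` and a common MATCHED factor `D ≥ 0`
(the follower determinant) that is `K`-constant on balls of radius `ρ₀` (w2 g60's leader-Lipschitz law).  Pointwise in `p` the slab beats the shell near `Σ = {p = 0}`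
(`∫_{|δ|<s} B₀⁻¹ ≈ π/|p|`); smeared over balls of radius `ρ₀` it does not:
★★★ `smeared_slab_shell_comparison`:
    `A_sh·(2rρ₀²/(9K)) · ∫_{(−s,s)×ℝ²} F_s ≤ 9·A_s·K·(144·s^{1/3} + 4·s·ρ₀²) · ∫_{[r/2,r]×ℝ²} F_sh`
(LEAD ✓`lintegral_prod_ball_smear`, w3 ✓`slab_integrand_le` ∕ ✓`lintegral_symm_slab_inv_sum_sq_le`; balls of `ℝ × ℝ` are sup-norm squares of area `4ρ₀²`).
So slab/shell `≲ K²·(A_s/A_sh)·s^{1/3}/(rρ₀²)`: with `s ≤ √τ` this is the polynomial rate ✓`gaussCore_of_rate` consumes.  §1: the weight on balls and on the unit box;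
§2: the pointwise majorant; §3: the per-ball bounds; §4: the comparison.

HONEST LABEL: elementary real analysis; `stub_end_gaussCore` (N1 rescaled converter, N2 pointwise fibre bound, the instantiation of this lemma, N4 ✓), stubs core-tip ∕
001-good of ➎, ⟨24197⟩ ∕ ⟨24194⟩ OPEN; own crux ⟨22884⟩ `LargeFieldMassRefinementTail` OPEN (blocked-on ⟨19935⟩); the Yang–Mills mass gap is NOT proved; no summit is
proved by a line.  THEOREMS ONLY (0 `def`, 0 `sorry`, no instance), standard axioms.  LEAD seat ym-line-sfw-p2 g99 (cell ym-idea-1, free hands),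
`--supports stmt-QuantumFields-24197`.  References: [folklore].
-/

set_option autoImplicit false

noncomputable section

open MeasureTheory Set Metric
open scoped ENNReal

namespace Summit.QuantumFields.YangMills.Theorems.SwapVirialDeficit.SigmaBall

open Summit.QuantumFields.YangMills.Theorems.SwapVirialDeficit.SectorLaplace (lintegral_prod_ball_smear)

/-! ## §1 The E1 weight on balls and on the unit box -/

/-- `|x − x′| < 1 ⟹ (1+x²)⁻¹ ≤ 3·(1+x′²)⁻¹` (`1 + x′² ≤ 3(1 + x²)`). [folklore] -/
theorem inv_one_add_sq_le_three_mul {x x' : ℝ} (h : |x - x'| < 1) : (1 + x ^ 2)⁻¹ ≤ 3 * (1 + x' ^ 2)⁻¹ := by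
  obtain ⟨h1, h2⟩ := abs_lt.1 h
  have hd : (x - x') ^ 2 < 1 := by nlinarith
  have hle : 1 + x' ^ 2 ≤ 3 * (1 + x ^ 2) := by nlinarith [sq_nonneg (2 * x - x')]
  rw [show 3 * (1 + x' ^ 2)⁻¹ = ((1 + x' ^ 2) / 3)⁻¹ by rw [inv_div]; ring]
  exact inv_anti₀ (by positivity) (by linarith)

/-- On a sup-norm ball of radius `ρ₀ ≤ 1`: `w(p) ≤ 9·w(p′)`, `w = (1+x₀²)⁻¹(1+y₀²)⁻¹`. [folklore] -/
theorem weight_le_nine_mul {p p' : ℝ × ℝ} {ρ₀ : ℝ} (hρ1 : ρ₀ ≤ 1) (h : dist p p' < ρ₀) :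
    (1 + p.1 ^ 2)⁻¹ * (1 + p.2 ^ 2)⁻¹ ≤ 9 * ((1 + p'.1 ^ 2)⁻¹ * (1 + p'.2 ^ 2)⁻¹) := by
  have h1 : |p.1 - p'.1| < 1 := by
    have := (le_max_left _ _).trans_lt (Prod.dist_eq (x := p) (y := p') ▸ h)
    rw [Real.dist_eq] at this; linarith
  have h2 : |p.2 - p'.2| < 1 := by
    have := (le_max_right _ _).trans_lt (Prod.dist_eq (x := p) (y := p') ▸ h)
    rw [Real.dist_eq] at this; linarith
  have a := inv_one_add_sq_le_three_mul h1
  have b := inv_one_add_sq_le_three_mul h2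
  calc (1 + p.1 ^ 2)⁻¹ * (1 + p.2 ^ 2)⁻¹ ≤ (3 * (1 + p'.1 ^ 2)⁻¹) * (3 * (1 + p'.2 ^ 2)⁻¹) := mul_le_mul a b (by positivity) (by positivity)
    _ = _ := by ring

/-- On the unit box `|x₀|, |y₀| < 1`: `¼ ≤ w(p)`. [folklore] -/
theorem quarter_le_weight_of_box {p : ℝ × ℝ} (hp : p ∈ Ioo (-1 : ℝ) 1 ×ˢ Ioo (-1 : ℝ) 1) : (1 / 4 : ℝ) ≤ (1 + p.1 ^ 2)⁻¹ * (1 + p.2 ^ 2)⁻¹ := by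
  obtain ⟨⟨h1, h2⟩, ⟨h3, h4⟩⟩ := hp
  have hx : p.1 ^ 2 ≤ 1 := by nlinarith
  have hy : p.2 ^ 2 ≤ 1 := by nlinarith
  have a : (1 / 2 : ℝ) ≤ (1 + p.1 ^ 2)⁻¹ := by rw [le_inv_comm₀ (by norm_num) (by positivity)]; norm_num; linarith
  have b : (1 / 2 : ℝ) ≤ (1 + p.2 ^ 2)⁻¹ := by rw [le_inv_comm₀ (by norm_num) (by positivity)]; norm_num; linarith
  calc (1 / 4 : ℝ) = 1 / 2 * (1 / 2) := by norm_num
    _ ≤ _ := mul_le_mul a b (by norm_num) (by positivity)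

/-! ## §2 The pointwise majorant of the slab integrand on a ball -/

/-- Scalar bookkeeping: `A_s·D(p)·(w(p)B₀⁻¹) ≤ 18A_sK·D(p′)w(p′)·ind + (9/2)A_sK·D(p′)w(p′)` from the four pointwise facts. [folklore] -/
theorem slab_scalar_majorant {As K Dp Dp' wp wp' ind B : ℝ} (hAs : 0 ≤ As) (hDp : 0 ≤ Dp) (hDK : Dp ≤ K * Dp') (hind : 0 ≤ ind)
    (hw0 : 0 ≤ wp) (hww : wp ≤ 9 * wp') (hmain : wp * B ≤ 1 / 2 * ind + 1 / 2 * wp) (hbox : 1 / 2 * ind ≤ 2 * wp * ind) :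
    As * Dp * (wp * B) ≤ 18 * As * K * (Dp' * wp') * ind + 9 * As * K * (Dp' * wp') / 2 := by
  have h1 : wp * B ≤ wp * (2 * ind + 1 / 2) := by nlinarith
  have h2 : As * Dp * (wp * B) ≤ As * Dp * (wp * (2 * ind + 1 / 2)) := mul_le_mul_of_nonneg_left h1 (mul_nonneg hAs hDp)
  have h3 : Dp * wp ≤ K * Dp' * (9 * wp') := mul_le_mul hDK hww hw0 (hDp.trans hDK)
  have h4 : As * Dp * (wp * (2 * ind + 1 / 2)) = As * (Dp * wp) * (2 * ind + 1 / 2) := by ring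
  have h5 : As * (Dp * wp) * (2 * ind + 1 / 2) ≤ As * (K * Dp' * (9 * wp')) * (2 * ind + 1 / 2) :=
    mul_le_mul_of_nonneg_right (mul_le_mul_of_nonneg_left h3 hAs) (by positivity)
  calc As * Dp * (wp * B) ≤ As * (K * Dp' * (9 * wp')) * (2 * ind + 1 / 2) := by rw [← h4] at h5; exact h2.trans h5
    _ = _ := by ring

/-- ★ **THE POINTWISE MAJORANT**: for `δ² ≤ 1`, `p` in the sup-ball `B(p′, ρ₀)` (`ρ₀ ≤ 1`), `D ≥ 0` with `D(p) ≤ K·D(p′)`: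
`ofReal(A_s·D(p)·w(p)·B₀(δ,p)⁻¹) ≤ ofReal(18A_sK·D(p′)w(p′))·𝟙_{ℝ×(−1,1)²}(δ,p)·ofReal((δ²+x₀²+y₀²)⁻¹) + ofReal(9A_sK·D(p′)w(p′)/2)` (w3 ✓`slab_integrand_le`). [folklore] -/
theorem slab_pointwise_majorant {As K ρ₀ δ : ℝ} (hAs : 0 ≤ As) (hρ1 : ρ₀ ≤ 1) (hδ : δ ^ 2 ≤ 1) {D : ℝ × ℝ → ℝ} (hD0 : ∀ p, 0 ≤ D p)
    {p p' : ℝ × ℝ} (hp : dist p p' < ρ₀) (hDK : D p ≤ K * D p') :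
    ENNReal.ofReal (As * D p * ((1 + p.1 ^ 2)⁻¹ * (1 + p.2 ^ 2)⁻¹ *
        (16 * δ ^ 2 / (1 + δ ^ 2) + 8 * p.1 ^ 2 / ((1 + p.1 ^ 2) * (1 + δ ^ 2)) + 4 * p.2 ^ 2 / (1 + p.2 ^ 2))⁻¹)) ≤
      ENNReal.ofReal (18 * As * K * (D p' * ((1 + p'.1 ^ 2)⁻¹ * (1 + p'.2 ^ 2)⁻¹))) *
          ((univ : Set ℝ) ×ˢ (Ioo (-1 : ℝ) 1 ×ˢ Ioo (-1 : ℝ) 1)).indicator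
            (fun q : ℝ × (ℝ × ℝ) => ENNReal.ofReal ((q.1 ^ 2 + q.2.1 ^ 2 + q.2.2 ^ 2)⁻¹)) (δ, p) +
        ENNReal.ofReal (9 * As * K * (D p' * ((1 + p'.1 ^ 2)⁻¹ * (1 + p'.2 ^ 2)⁻¹)) / 2) := by
  set wp : ℝ := (1 + p.1 ^ 2)⁻¹ * (1 + p.2 ^ 2)⁻¹ with hwp
  set wp' : ℝ := (1 + p'.1 ^ 2)⁻¹ * (1 + p'.2 ^ 2)⁻¹ with hwp'
  set B : ℝ := (16 * δ ^ 2 / (1 + δ ^ 2) + 8 * p.1 ^ 2 / ((1 + p.1 ^ 2) * (1 + δ ^ 2)) + 4 * p.2 ^ 2 / (1 + p.2 ^ 2))⁻¹ with hB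
  set ind : ℝ := (Ioo (-1 : ℝ) 1 ×ˢ Ioo (-1 : ℝ) 1).indicator (fun q : ℝ × ℝ => (δ ^ 2 + q.1 ^ 2 + q.2 ^ 2)⁻¹) p with hind
  have hw0 : 0 ≤ wp := by positivity
  have hww : wp ≤ 9 * wp' := weight_le_nine_mul hρ1 hp
  have hind0 : 0 ≤ ind := by
    rw [hind]; by_cases h : p ∈ Ioo (-1 : ℝ) 1 ×ˢ Ioo (-1 : ℝ) 1
    · rw [indicator_of_mem h]; positivity
    · rw [indicator_of_notMem h]
  have hmain : wp * B ≤ 1 / 2 * ind + 1 / 2 * wp := by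
    have h := slab_integrand_le (x₀ := p.1) (y₀ := p.2) hδ
    rw [hwp, hB, hind]
    have e : ((p.1, p.2) : ℝ × ℝ) = p := Prod.mk.eta
    rw [e] at h
    linarith
  have hbox : 1 / 2 * ind ≤ 2 * wp * ind := by
    rw [hind]; by_cases h : p ∈ Ioo (-1 : ℝ) 1 ×ˢ Ioo (-1 : ℝ) 1
    · rw [indicator_of_mem h]
      have hq := quarter_le_weight_of_box h
      have h0 : 0 ≤ (δ ^ 2 + p.1 ^ 2 + p.2 ^ 2)⁻¹ := by positivity
      rw [← hwp] at hq
      nlinarith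
    · rw [indicator_of_notMem h]; simp
  have hreal := slab_scalar_majorant (B := B) hAs (hD0 p) hDK hind0 hw0 hww hmain hbox
  -- pass to `ℝ≥0∞`
  have hc₁ : 0 ≤ 18 * As * K * (D p' * wp') * ind := by
    have hK : 0 ≤ K * D p' := (hD0 p).trans hDK
    have : 0 ≤ 18 * As * (K * D p') * wp' * ind := by positivity
    linarith [this]
  have hc₂ : 0 ≤ 9 * As * K * (D p' * wp') / 2 := by
    have hK : 0 ≤ K * D p' := (hD0 p).trans hDK
    have : 0 ≤ 9 * As * (K * D p') * wp' / 2 := by positivity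
    linarith [this]
  calc ENNReal.ofReal (As * D p * (wp * B))
      ≤ ENNReal.ofReal (18 * As * K * (D p' * wp') * ind + 9 * As * K * (D p' * wp') / 2) := ENNReal.ofReal_le_ofReal hreal
    _ = ENNReal.ofReal (18 * As * K * (D p' * wp') * ind) + ENNReal.ofReal (9 * As * K * (D p' * wp') / 2) := ENNReal.ofReal_add hc₁ hc₂
    _ = ENNReal.ofReal (18 * As * K * (D p' * wp')) *
          ((univ : Set ℝ) ×ˢ (Ioo (-1 : ℝ) 1 ×ˢ Ioo (-1 : ℝ) 1)).indicator
            (fun q : ℝ × (ℝ × ℝ) => ENNReal.ofReal ((q.1 ^ 2 + q.2.1 ^ 2 + q.2.2 ^ 2)⁻¹)) (δ, p) +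
        ENNReal.ofReal (9 * As * K * (D p' * wp') / 2) := by
        congr 1
        have hz : 0 ≤ 18 * As * K * (D p' * wp') := by
          have hK : 0 ≤ K * D p' := (hD0 p).trans hDK
          have : 0 ≤ 18 * As * (K * D p') * wp' := by positivity
          linarith [this]
        rw [hind]
        by_cases h : p ∈ Ioo (-1 : ℝ) 1 ×ˢ Ioo (-1 : ℝ) 1
        · have h' : ((δ, p) : ℝ × (ℝ × ℝ)) ∈ (univ : Set ℝ) ×ˢ (Ioo (-1 : ℝ) 1 ×ˢ Ioo (-1 : ℝ) 1) := ⟨mem_univ _, h⟩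
          simp only [indicator_of_mem h, indicator_of_mem h']
          rw [← ENNReal.ofReal_mul hz]
        · have h' : ((δ, p) : ℝ × (ℝ × ℝ)) ∉ (univ : Set ℝ) ×ˢ (Ioo (-1 : ℝ) 1 ×ˢ Ioo (-1 : ℝ) 1) := fun hh => h hh.2
          simp only [indicator_of_notMem h, indicator_of_notMem h', mul_zero, ENNReal.ofReal_zero]

/-! ## §3 Volumes of the slab∕shell pieces over a ball -/

/-- The sup-norm ball of `ℝ × ℝ` has area `4ρ₀²`. [folklore] -/
theorem volume_ball_prod (p' : ℝ × ℝ) {ρ₀ : ℝ} (hρ0 : 0 ≤ ρ₀) : volume (ball p' ρ₀) = ENNReal.ofReal (4 * ρ₀ ^ 2) := by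
  rw [← ball_prod_same, Measure.volume_eq_prod, Measure.prod_prod, Real.volume_ball, Real.volume_ball, ← ENNReal.ofReal_mul (by linarith)]
  congr 1; ring

/-- `vol((−s,s) × B(p′,ρ₀)) = 2s·4ρ₀²`. [folklore] -/
theorem volume_slab_ball (p' : ℝ × ℝ) {s ρ₀ : ℝ} (hs : 0 ≤ s) (hρ0 : 0 ≤ ρ₀) :
    volume (Ioo (-s) s ×ˢ ball p' ρ₀) = ENNReal.ofReal (2 * s * (4 * ρ₀ ^ 2)) := by
  rw [Measure.volume_eq_prod, Measure.prod_prod, Real.volume_Ioo, volume_ball_prod p' hρ0, ← ENNReal.ofReal_mul (by linarith)]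
  congr 1; ring

/-- `vol([r/2,r] × B(p′,ρ₀)) = (r/2)·4ρ₀²`. [folklore] -/
theorem volume_shell_ball (p' : ℝ × ℝ) {r ρ₀ : ℝ} (hr : 0 ≤ r) (hρ0 : 0 ≤ ρ₀) :
    volume (Icc (r / 2) r ×ˢ ball p' ρ₀) = ENNReal.ofReal (r / 2 * (4 * ρ₀ ^ 2)) := by
  rw [Measure.volume_eq_prod, Measure.prod_prod, Real.volume_Icc, volume_ball_prod p' hρ0, ← ENNReal.ofReal_mul (by linarith)]
  congr 1; ring

/-! ## §4 The smeared comparison -/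

set_option maxHeartbeats 800000 in
/-- ★★★ **THE SMEARED SLAB–SHELL COMPARISON.**  Let `0 < s ≤ 1`, `0 < ρ₀ ≤ 1`, `0 < r`, `1 ≤ K`, `A_s, A_sh ≥ 0`, `D ≥ 0` with `D(p) ≤ K·D(p′)` whenever
`dist p p′ < ρ₀` (sup distance on `ℝ × ℝ`), and measurable `F_s, F_sh ≥ 0` on `ℝ × ℝ²` with
`F_s(δ,p) ≤ ofReal(A_s·D(p)·w(p)·B₀(δ,p)⁻¹)` for `|δ| < s` and `ofReal(A_sh·D(p)·w(p)) ≤ F_sh(δ′,p)` for `δ′ ∈ [r/2, r]`.  Then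
`ofReal(A_sh·2rρ₀²/(9K)) · ∫⁻_{(−s,s)×ℝ²} F_s ≤ ofReal(9A_sK·(144·s^{1/3} + 4sρ₀²)) · ∫⁻_{[r/2,r]×ℝ²} F_sh`. [folklore] -/
theorem smeared_slab_shell_comparison {s ρ₀ r K As Ash : ℝ} (hs0 : 0 < s) (hs1 : s ≤ 1) (hρ0 : 0 < ρ₀) (hρ1 : ρ₀ ≤ 1) (hr : 0 < r)
    (hK : 1 ≤ K) (hAs : 0 ≤ As) (hAsh : 0 ≤ Ash) (D : ℝ × ℝ → ℝ) (hD0 : ∀ p, 0 ≤ D p)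
    (hDK : ∀ p p' : ℝ × ℝ, dist p p' < ρ₀ → D p ≤ K * D p')
    (Fs Fsh : ℝ × (ℝ × ℝ) → ℝ≥0∞) (hFs : Measurable Fs) (hFsh : Measurable Fsh)
    (hslab : ∀ (δ : ℝ) (p : ℝ × ℝ), δ ∈ Ioo (-s) s →
      Fs (δ, p) ≤ ENNReal.ofReal (As * D p * ((1 + p.1 ^ 2)⁻¹ * (1 + p.2 ^ 2)⁻¹ *
        (16 * δ ^ 2 / (1 + δ ^ 2) + 8 * p.1 ^ 2 / ((1 + p.1 ^ 2) * (1 + δ ^ 2)) + 4 * p.2 ^ 2 / (1 + p.2 ^ 2))⁻¹)))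
    (hshell : ∀ (δ' : ℝ) (p : ℝ × ℝ), δ' ∈ Icc (r / 2) r →
      ENNReal.ofReal (Ash * D p * ((1 + p.1 ^ 2)⁻¹ * (1 + p.2 ^ 2)⁻¹)) ≤ Fsh (δ', p)) :
    ENNReal.ofReal (Ash * (2 * r * ρ₀ ^ 2) / (9 * K)) * ∫⁻ q in Ioo (-s) s ×ˢ (univ : Set (ℝ × ℝ)), Fs q ≤
      ENNReal.ofReal (9 * As * K * (144 * s ^ (1 / 3 : ℝ) + 4 * s * ρ₀ ^ 2)) * ∫⁻ q in Icc (r / 2) r ×ˢ (univ : Set (ℝ × ℝ)), Fsh q := by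
  have hK0 : 0 < K := by linarith
  set cs : ℝ := 9 * As * K * (144 * s ^ (1 / 3 : ℝ) + 4 * s * ρ₀ ^ 2) with hcs
  set csh : ℝ := Ash * (2 * r * ρ₀ ^ 2) / (9 * K) with hcsh
  have hcs0 : 0 ≤ cs := by
    rw [hcs]
    have : 0 ≤ s ^ (1 / 3 : ℝ) := Real.rpow_nonneg hs0.le _
    have : 0 ≤ 144 * s ^ (1 / 3 : ℝ) + 4 * s * ρ₀ ^ 2 := by nlinarith [sq_nonneg ρ₀, hs0.le]
    exact mul_nonneg (mul_nonneg (mul_nonneg (by norm_num) hAs) hK0.le) this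
  have hcsh0 : 0 ≤ csh := by
    rw [hcsh]
    exact div_nonneg (mul_nonneg hAsh (by nlinarith [sq_nonneg ρ₀, hr.le])) (by linarith)
  have hbox : MeasurableSet ((univ : Set ℝ) ×ˢ (Ioo (-1 : ℝ) 1 ×ˢ Ioo (-1 : ℝ) 1)) := MeasurableSet.univ.prod (measurableSet_Ioo.prod measurableSet_Ioo)
  have hIm : Measurable fun q : ℝ × (ℝ × ℝ) => ENNReal.ofReal ((q.1 ^ 2 + q.2.1 ^ 2 + q.2.2 ^ 2)⁻¹) := by
    refine ENNReal.measurable_ofReal.comp ?_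
    exact (((measurable_fst.pow_const 2).add ((measurable_fst.comp measurable_snd).pow_const 2)).add
      ((measurable_snd.comp measurable_snd).pow_const 2)).inv
  -- §A the per-ball SLAB bound
  have hSB : ∀ p' : ℝ × ℝ, ∫⁻ q in Ioo (-s) s ×ˢ ball p' ρ₀, Fs q ≤
      ENNReal.ofReal (cs * (D p' * ((1 + p'.1 ^ 2)⁻¹ * (1 + p'.2 ^ 2)⁻¹))) := by
    intro p'
    set Dw : ℝ := D p' * ((1 + p'.1 ^ 2)⁻¹ * (1 + p'.2 ^ 2)⁻¹) with hDw
    have hDw0 : 0 ≤ Dw := mul_nonneg (hD0 p') (by positivity)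
    have h18 : 0 ≤ 18 * As * K * Dw := mul_nonneg (mul_nonneg (mul_nonneg (by norm_num) hAs) hK0.le) hDw0
    have h92 : 0 ≤ 9 * As * K * Dw / 2 := div_nonneg (mul_nonneg (mul_nonneg (mul_nonneg (by norm_num) hAs) hK0.le) hDw0) (by norm_num)
    have hmeas : MeasurableSet (Ioo (-s) s ×ˢ ball p' ρ₀) := measurableSet_Ioo.prod measurableSet_ball
    have hpt : ∀ q ∈ Ioo (-s) s ×ˢ ball p' ρ₀, Fs q ≤
        ENNReal.ofReal (18 * As * K * Dw) * ((univ : Set ℝ) ×ˢ (Ioo (-1 : ℝ) 1 ×ˢ Ioo (-1 : ℝ) 1)).indicator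
            (fun q : ℝ × (ℝ × ℝ) => ENNReal.ofReal ((q.1 ^ 2 + q.2.1 ^ 2 + q.2.2 ^ 2)⁻¹)) q +
          ENNReal.ofReal (9 * As * K * Dw / 2) := by
      rintro ⟨δ, p⟩ ⟨hδ, hp⟩
      have hδ1 : δ ^ 2 ≤ 1 := by
        have := hδ.1; have := hδ.2; nlinarith
      exact (hslab δ p hδ).trans (slab_pointwise_majorant hAs hρ1 hδ1 hD0 (mem_ball.1 hp) (hDK p p' (mem_ball.1 hp)))
    have hboxint : ∫⁻ q in Ioo (-s) s ×ˢ ball p' ρ₀, ((univ : Set ℝ) ×ˢ (Ioo (-1 : ℝ) 1 ×ˢ Ioo (-1 : ℝ) 1)).indicator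
        (fun q : ℝ × (ℝ × ℝ) => ENNReal.ofReal ((q.1 ^ 2 + q.2.1 ^ 2 + q.2.2 ^ 2)⁻¹)) q ≤ ENNReal.ofReal (72 * s ^ (1 / 3 : ℝ)) := by
      rw [lintegral_indicator hbox, Measure.restrict_restrict hbox]
      calc ∫⁻ q in (univ : Set ℝ) ×ˢ (Ioo (-1 : ℝ) 1 ×ˢ Ioo (-1 : ℝ) 1) ∩ Ioo (-s) s ×ˢ ball p' ρ₀,
            ENNReal.ofReal ((q.1 ^ 2 + q.2.1 ^ 2 + q.2.2 ^ 2)⁻¹)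
          ≤ ∫⁻ q in Ioo (-s) s ×ˢ (Ioo (-(1:ℝ)) 1 ×ˢ Ioo (-(1:ℝ)) 1), ENNReal.ofReal ((q.1 ^ 2 + q.2.1 ^ 2 + q.2.2 ^ 2)⁻¹) := by
            refine lintegral_mono_set ?_
            rintro ⟨δ, p⟩ ⟨⟨-, hb⟩, ⟨hδ, -⟩⟩
            exact ⟨hδ, hb⟩
        _ ≤ ENNReal.ofReal (72 * s ^ (1 / 3 : ℝ) * (1 : ℝ) ^ (1 / 3 : ℝ) * (1 : ℝ) ^ (1 / 3 : ℝ)) :=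
            lintegral_symm_slab_inv_sum_sq_le hs0.le zero_le_one zero_le_one
        _ = ENNReal.ofReal (72 * s ^ (1 / 3 : ℝ)) := by rw [Real.one_rpow, mul_one, mul_one]
    calc ∫⁻ q in Ioo (-s) s ×ˢ ball p' ρ₀, Fs q
        ≤ ∫⁻ q in Ioo (-s) s ×ˢ ball p' ρ₀, (ENNReal.ofReal (18 * As * K * Dw) *
            ((univ : Set ℝ) ×ˢ (Ioo (-1 : ℝ) 1 ×ˢ Ioo (-1 : ℝ) 1)).indicator
              (fun q : ℝ × (ℝ × ℝ) => ENNReal.ofReal ((q.1 ^ 2 + q.2.1 ^ 2 + q.2.2 ^ 2)⁻¹)) q +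
            ENNReal.ofReal (9 * As * K * Dw / 2)) := setLIntegral_mono' hmeas hpt
      _ = ENNReal.ofReal (18 * As * K * Dw) * (∫⁻ q in Ioo (-s) s ×ˢ ball p' ρ₀, ((univ : Set ℝ) ×ˢ (Ioo (-1 : ℝ) 1 ×ˢ Ioo (-1 : ℝ) 1)).indicator
              (fun q : ℝ × (ℝ × ℝ) => ENNReal.ofReal ((q.1 ^ 2 + q.2.1 ^ 2 + q.2.2 ^ 2)⁻¹)) q) +
          ENNReal.ofReal (9 * As * K * Dw / 2) * volume (Ioo (-s) s ×ˢ ball p' ρ₀) := by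
          have e1 := lintegral_add_right (μ := (volume : Measure (ℝ × (ℝ × ℝ))).restrict (Ioo (-s) s ×ˢ ball p' ρ₀))
            (fun q : ℝ × (ℝ × ℝ) => ENNReal.ofReal (18 * As * K * Dw) * ((univ : Set ℝ) ×ˢ (Ioo (-1 : ℝ) 1 ×ˢ Ioo (-1 : ℝ) 1)).indicator
              (fun q : ℝ × (ℝ × ℝ) => ENNReal.ofReal ((q.1 ^ 2 + q.2.1 ^ 2 + q.2.2 ^ 2)⁻¹)) q)
            (measurable_const : Measurable fun _ : ℝ × (ℝ × ℝ) => ENNReal.ofReal (9 * As * K * Dw / 2))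
          rw [e1, lintegral_const_mul _ (hIm.indicator hbox), setLIntegral_const]
      _ ≤ ENNReal.ofReal (18 * As * K * Dw) * ENNReal.ofReal (72 * s ^ (1 / 3 : ℝ)) +
          ENNReal.ofReal (9 * As * K * Dw / 2) * ENNReal.ofReal (2 * s * (4 * ρ₀ ^ 2)) := by
          rw [volume_slab_ball p' hs0.le hρ0.le]
          exact add_le_add (mul_le_mul' le_rfl hboxint) le_rfl
      _ = ENNReal.ofReal (cs * Dw) := by
          rw [← ENNReal.ofReal_mul h18, ← ENNReal.ofReal_mul h92, ← ENNReal.ofReal_add (mul_nonneg h18 (by positivity)) (mul_nonneg h92 (by positivity))]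
          congr 1; rw [hcs]; ring
  -- §B the per-ball SHELL bound
  have hShB : ∀ p' : ℝ × ℝ, ENNReal.ofReal (csh * (D p' * ((1 + p'.1 ^ 2)⁻¹ * (1 + p'.2 ^ 2)⁻¹))) ≤
      ∫⁻ q in Icc (r / 2) r ×ˢ ball p' ρ₀, Fsh q := by
    intro p'
    set wp' : ℝ := (1 + p'.1 ^ 2)⁻¹ * (1 + p'.2 ^ 2)⁻¹ with hwp'
    have hmeas : MeasurableSet (Icc (r / 2) r ×ˢ ball p' ρ₀) := measurableSet_Icc.prod measurableSet_ball
    have hpt : ∀ q ∈ Icc (r / 2) r ×ˢ ball p' ρ₀, ENNReal.ofReal (Ash * (D p' / K) * (wp' / 9)) ≤ Fsh q := by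
      rintro ⟨δ', p⟩ ⟨hδ', hp⟩
      have hd : dist p' p < ρ₀ := by rw [dist_comm]; exact mem_ball.1 hp
      have hDp : D p' / K ≤ D p := by rw [div_le_iff₀ hK0]; linarith [hDK p' p hd, mul_comm K (D p)]
      have hwp : wp' / 9 ≤ (1 + p.1 ^ 2)⁻¹ * (1 + p.2 ^ 2)⁻¹ := by
        rw [div_le_iff₀ (by norm_num)]; linarith [weight_le_nine_mul hρ1 hd]
      refine le_trans (ENNReal.ofReal_le_ofReal ?_) (hshell δ' p hδ')
      exact mul_le_mul (mul_le_mul_of_nonneg_left hDp hAsh) hwp (by positivity) (mul_nonneg hAsh (hD0 p))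
    calc ENNReal.ofReal (csh * (D p' * wp'))
        = ENNReal.ofReal (Ash * (D p' / K) * (wp' / 9)) * volume (Icc (r / 2) r ×ˢ ball p' ρ₀) := by
          rw [volume_shell_ball p' hr.le hρ0.le, ← ENNReal.ofReal_mul (mul_nonneg (mul_nonneg hAsh (div_nonneg (hD0 p') hK0.le)) (by positivity))]
          congr 1; rw [hcsh]; field_simp; ring
      _ = ∫⁻ q in Icc (r / 2) r ×ˢ ball p' ρ₀, ENNReal.ofReal (Ash * (D p' / K) * (wp' / 9)) := (setLIntegral_const _ _).symm
      _ ≤ ∫⁻ q in Icc (r / 2) r ×ˢ ball p' ρ₀, Fsh q := setLIntegral_mono' hmeas hpt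
  -- §C per ball: `csh·SB ≤ cs·ShB`
  have hball : ∀ p' : ℝ × ℝ, ENNReal.ofReal csh * ∫⁻ q in Ioo (-s) s ×ˢ ball p' ρ₀, Fs q ≤
      ENNReal.ofReal cs * ∫⁻ q in Icc (r / 2) r ×ˢ ball p' ρ₀, Fsh q := by
    intro p'
    calc ENNReal.ofReal csh * ∫⁻ q in Ioo (-s) s ×ˢ ball p' ρ₀, Fs q
        ≤ ENNReal.ofReal csh * ENNReal.ofReal (cs * (D p' * ((1 + p'.1 ^ 2)⁻¹ * (1 + p'.2 ^ 2)⁻¹))) := mul_le_mul' le_rfl (hSB p')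
      _ = ENNReal.ofReal cs * ENNReal.ofReal (csh * (D p' * ((1 + p'.1 ^ 2)⁻¹ * (1 + p'.2 ^ 2)⁻¹))) := by
          rw [← ENNReal.ofReal_mul hcsh0, ← ENNReal.ofReal_mul hcs0]; congr 1; ring
      _ ≤ ENNReal.ofReal cs * ∫⁻ q in Icc (r / 2) r ×ˢ ball p' ρ₀, Fsh q := mul_le_mul' le_rfl (hShB p')
  -- §D smear both sides (LEAD ✓`lintegral_prod_ball_smear`) and cancel the ball volume
  have hV0 : volume (ball (0 : ℝ × ℝ) ρ₀) = ENNReal.ofReal (4 * ρ₀ ^ 2) := volume_ball_prod 0 hρ0.le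
  have hVpos : volume (ball (0 : ℝ × ℝ) ρ₀) ≠ 0 := by rw [hV0]; exact (ENNReal.ofReal_pos.2 (by positivity)).ne'
  have hVtop : volume (ball (0 : ℝ × ℝ) ρ₀) ≠ ⊤ := by rw [hV0]; exact ENNReal.ofReal_ne_top
  -- the restricted product measures
  have hprod : ∀ S : Set ℝ, MeasurableSet S →
      ((volume : Measure ℝ).restrict S).prod (volume : Measure (ℝ × ℝ)) = (volume : Measure (ℝ × (ℝ × ℝ))).restrict (S ×ˢ univ) := by
    intro S hS
    rw [Measure.volume_eq_prod (α := ℝ) (β := ℝ × ℝ), ← Measure.prod_restrict, Measure.restrict_univ]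
  have hsmear : ∀ (S : Set ℝ), MeasurableSet S → ∀ (F : ℝ × (ℝ × ℝ) → ℝ≥0∞), Measurable F →
      volume (ball (0 : ℝ × ℝ) ρ₀) * ∫⁻ q in S ×ˢ (univ : Set (ℝ × ℝ)), F q = ∫⁻ p', ∫⁻ q in S ×ˢ ball p' ρ₀, F q := by
    intro S hS F hF
    have h := lintegral_prod_ball_smear (volume : Measure (ℝ × ℝ)) ((volume : Measure ℝ).restrict S) ρ₀ F hF
    rw [hprod S hS] at h
    rw [h]
    refine lintegral_congr fun p' => ?_
    rw [Measure.restrict_restrict (MeasurableSet.univ.prod measurableSet_ball), Set.prod_inter_prod, Set.univ_inter, Set.inter_univ]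
  have hL := hsmear (Ioo (-s) s) measurableSet_Ioo Fs hFs
  have hR := hsmear (Icc (r / 2) r) measurableSet_Icc Fsh hFsh
  -- integrate §C over the centres
  have hint : ENNReal.ofReal csh * ∫⁻ p', ∫⁻ q in Ioo (-s) s ×ˢ ball p' ρ₀, Fs q ≤
      ENNReal.ofReal cs * ∫⁻ p', ∫⁻ q in Icc (r / 2) r ×ˢ ball p' ρ₀, Fsh q := by
    rw [← lintegral_const_mul' _ _ ENNReal.ofReal_ne_top, ← lintegral_const_mul' _ _ ENNReal.ofReal_ne_top]
    exact lintegral_mono fun p' => hball p'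
  rw [← hL, ← hR, ← mul_assoc, ← mul_assoc, mul_comm (ENNReal.ofReal csh), mul_comm (ENNReal.ofReal cs), mul_assoc, mul_assoc] at hint
  exact (ENNReal.mul_le_mul_iff_right hVpos hVtop).1 hint

end Summit.QuantumFields.YangMills.Theorems.SwapVirialDeficit.SigmaBall

end
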